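import Summits.ValiantsHypothesis.ValiantsHypothesis.Theorems.DualUnipotentThreeHalves.Negative.InflatedReturns

/-!
PORT (val-port-2 g3, Negative lane of 24318, director R310 (1) «press-ready on port-2's lane», critic val-idea-crit-7 g3 22:36:35Z (4) no objection):
verbatim copy of val-idea-30 g3's crux workfile `Cruxes/DualUnipotentThreeHalves/RigidWordFour.lean` (statements, proofs, docstrings = the author's);
only the namespace is changed (`…Cruxes.….RatioKnapsack[.General]` → `…Theorems.DualUnipotentThreeHalvesNegative.RigidWordFour`) and this note added.

# Rigid words in the inflated return `U_{4,k}` (val-idea-30 g3, MEMO rev 2 §4.3, the case h = 4, λ = 1)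

For ONE edge `a → b` (`a ≠ b`) put `T₁ := J₄ ⊗ E_ab` (a climber available to the certifier) and
`T₀ := J₄ ⊗ E_ba + R₂ ⊗ 1` (the refuter's constant letter).  The period word `W := T₁ T₀ T₀` has exactly two
surviving expansion terms, `J₄²R₂ ⊗ E_aa` and `J₄R₂J₄ ⊗ E_aa`, which do NOT cancel:
`W = G ⊗ E_aa`, `G = E₀₀ − E₂₂`, and `W^{2j+1} = W ≠ 0`.  Hence every profile `(r, c, Θ)` taming the pair
`(T₀, T₁)` has `c·(2j+1) ≤ Θ + r·(4j+2)` for all `j`, i.e. `ρ = r/c ≥ 1/2 = (h−2)/h` — the λ = 1 instance of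
the rigid-word bound `ρ ≥ λ(h−2)/(h−1+λ)` (general even h: MEMO §4.3, machine check `rigid_words.py`).
Honest framing: a finite matrix identity; nothing here is R2, the crux or VP ≠ VNP (NOT proved).
-/

-- single-conjunct layout: Sub = Summit, duplicated namespace component intended (the name is mandated)
set_option linter.dupNamespace false

noncomputable section

namespace Summit.ValiantsHypothesis.ValiantsHypothesis.Theorems.DualUnipotentThreeHalvesNegative.RigidWordFour

open Matrix
open scoped Kronecker
open Summit.ValiantsHypothesis.ValiantsHypothesis.Theorems.DualUnipotentThreeHalvesNegative.InflatedReturns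

/-- `G = J₄²R₂ + J₄R₂J₄ = E₀₀ − E₂₂`. -/
def G : Matrix (Fin 4) (Fin 4) ℂ := !![1, 0, 0, 0; 0, 0, 0, 0; 0, 0, -1, 0; 0, 0, 0, 0]

/-- `J₄R₂R₂ = 0`. [val-idea-30 g3] -/
lemma J4_R2_R2 : J4 * R2 * R2 = 0 := by
  rw [Matrix.mul_assoc, R2_mul_R2, Matrix.mul_zero]

/-- `G³ = G`. [val-idea-30 g3] -/
lemma G_mul_G_mul_G : G * G * G = G := by
  ext i j; fin_cases i <;> fin_cases j <;> simp [G, Matrix.mul_apply, Fin.sum_univ_four]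

/-- `G ≠ 0`. [val-idea-30 g3] -/
lemma G_ne_zero : G ≠ 0 := by
  intro h
  have := congr_fun (congr_fun h 0) 0
  simp [G] at this

variable {k : ℕ}

/-- **Rigid period** (h = 4, one edge): `(J₄⊗E_ab)·(J₄⊗E_ba + R₂⊗1)² = (J₄²R₂ + J₄R₂J₄) ⊗ E_aa = G ⊗ E_aa`. -/
theorem rigid_period (a b : Fin k) (hab : a ≠ b) :
    infl k (single a b 1) 0 * infl k (single b a 1) 1 * infl k (single b a 1) 1 = G ⊗ₖ single a a (1 : ℂ) := by
  have hba : single a a (1 : ℂ) * single b a (1 : ℂ) = 0 := by simp [hab]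
  simp only [infl, zero_smul, add_zero, one_smul, mul_add, add_mul, ← mul_kronecker_mul,
    single_mul_single_same, mul_one, hba, J4_R2_R2, zero_kronecker, kronecker_zero, add_zero, zero_add]
  rw [← Matrix.add_kronecker]
  congr 1
  ext i j; fin_cases i <;> fin_cases j <;> simp [J4, R2, G, Matrix.add_apply]

/-- `(G ⊗ E_aa)³ = G ⊗ E_aa`. -/
lemma GE_cube (a : Fin k) :
    G ⊗ₖ single a a (1 : ℂ) * (G ⊗ₖ single a a (1 : ℂ)) * (G ⊗ₖ single a a (1 : ℂ)) = G ⊗ₖ single a a (1 : ℂ) := by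
  rw [← mul_kronecker_mul, ← mul_kronecker_mul, single_mul_single_same, single_mul_single_same, mul_one, mul_one,
    G_mul_G_mul_G]

/-- `G ⊗ E_aa ≠ 0`. [val-idea-30 g3] -/
lemma GE_ne_zero (a : Fin k) : G ⊗ₖ single a a (1 : ℂ) ≠ 0 := by
  intro h
  have := congr_fun (congr_fun h (0, a)) (0, a)
  simp [G, Matrix.kroneckerMap_apply] at this

/-- **Rigid word, all odd powers**: `W^{2j+1} = W` for `W = T₁T₀T₀`; in particular `W^{2j+1} ≠ 0`, a nonzero word with
`2j+1` true and `4j+2` false letters for every `j`. -/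
theorem rigid_word_odd_pow (a b : Fin k) (hab : a ≠ b) (j : ℕ) :
    (infl k (single a b 1) 0 * infl k (single b a 1) 1 * infl k (single b a 1) 1) ^ (2 * j + 1)
      = G ⊗ₖ single a a (1 : ℂ) := by
  rw [rigid_period a b hab]
  induction j with
  | zero => simp
  | succ j ih =>
      rw [show 2 * (j + 1) + 1 = (2 * j + 1) + 1 + 1 by ring, pow_succ, pow_succ, ih, GE_cube]

/-- The rigid period word has NON-ZERO odd powers: `W^{2j+1} ≠ 0`. [val-idea-30 g3] -/
theorem rigid_word_ne_zero (a b : Fin k) (hab : a ≠ b) (j : ℕ) :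
    (infl k (single a b 1) 0 * infl k (single b a 1) 1 * infl k (single b a 1) 1) ^ (2 * j + 1) ≠ 0 := by
  rw [rigid_word_odd_pow a b hab]; exact GE_ne_zero a

/-- The forced ratio: if `c·t ≤ Θ + r·f` holds for the letter counts `(t, f) = (2j+1, 4j+2)` of ALL the rigid words, then `c ≤ 2r`
(i.e. `ρ ≥ 1/2`). -/
theorem ratio_ge_half_of_tame (r c Θ : ℕ) (h : ∀ j : ℕ, c * (2 * j + 1) ≤ Θ + r * (4 * j + 2)) : c ≤ 2 * r := by
  by_contra hc
  push Not at hc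
  have := h (Θ + 1)
  nlinarith

end Summit.ValiantsHypothesis.ValiantsHypothesis.Theorems.DualUnipotentThreeHalvesNegative.RigidWordFour
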